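import Mathlib
import Literature.MathematicalPhysics.QuantumFieldTheory.OSSectorContinuation
import Literature.MathematicalPhysics.QuantumFieldTheory.OSReconstructionNoE1Proofs
import Summits.QuantumFields.YangMills.Theorems.MirrorModularBoostsPlanarSpectralConeTransfer
import HarnessLib

/-!
# The holomorphic contraction family on the operator cone (stub `stub_contractionFamily`, crux `PlanarSpectralCone`)

Line `two-mirror-lightcone-slots` of crux `MirrorModularBoosts.PlanarSpectralCone`
(stmt-QuantumFields-9664), TRANSFER step `C⁺ ⇒ C`.

Informal statement. Let `T` be a labelled Schwinger family on `ℝ⁴` with reflection positivity and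
translation invariance on `⁰𝒮`, and `h : OSReconstructionNoE1 T` its Osterwalder–Schrader reconstruction
(Hilbert space `ℋ`, `e^{-tH} = h.transfer t`, `U(a⃗) = h.translate a`, joint spectral measures
`h.IsJointSpectralMeasure ψ μ` of `(H, P⃗)`). If every joint spectral measure of every vector is carried by
the closed planar cone `{p₀ ≥ |p₁|}` (the operator cone `H ≥ |P₁|`), then for all `ψ, ψ' ∈ ℋ` there is
`Φ : ℂ × ℂ → ℂ` holomorphic on the tube `D = {(ζ, β) : |Im β| < Re ζ}` with
`Φ(t, b) = ⟪ψ, e^{-tH} U(b e₁) ψ'⟫` for `t > 0`, `b ∈ ℝ`, and `‖Φ‖ ≤ ‖ψ‖ ‖ψ'‖` on `D` — the matrix elements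
of `e^{−ζH + iβP₁}` as a contraction family, without any unbounded functional calculus.

This is, verbatim, the abstract half of the TRANSFER stub of line `positivity-disc-to-operator-cone` of the
same crux, already in the tree as
`Summit.QuantumFields.YangMills.Cruxes.PlanarSpectralCone.PositivityDiscToOperatorCone.Contraction.contractionFamily`
(`Theorems/MirrorModularBoostsPlanarSpectralConeTransfer.lean`); this file is the one-line alias in the
namespace of line `two-mirror-lightcone-slots`, as its skeleton requires.

Proof (of the aliased theorem; Kolmogorov/Gram-isometry route). Let `μ'` be a joint spectral measure of
`ψ'` (`exists_isJointSpectralMeasure_holds`; finite, carried by `{p₀ ≥ 0}` and, by the cone hypothesis, by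
`{|p₁| ≤ p₀}`). For `t ≥ 0`, `b ∈ ℝ` put `e_{t,b}(p) = e^{−tp₀ + ibp₁} ∈ L²(μ')` and
`V_{t,b} = e^{-tH} U(b e₁) ψ'`. The Gram identity `⟪e_{t,b}, e_{t',b'}⟫_{L²} = ⟪V_{t,b}, V_{t',b'}⟫_ℋ`
(self-adjointness and semigroup law of `e^{-tH}`, unitarity of `U` and `[U, e^{-tH}] = 0`,
`IsJointSpectralMeasure.inner_transfer_translate`) makes `∑ cᵢ e_{tᵢ,bᵢ} ↦ ⟪ψ, ∑ cᵢ V_{tᵢ,bᵢ}⟫` a well-defined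
functional on `span{e_{t,b}} ⊆ L²(μ')` bounded by `‖ψ‖`; Hahn–Banach and Riesz give `g ∈ L²(μ')` with
`‖g‖ ≤ ‖ψ‖` and `⟪g, e_{t,b}⟫ = ⟪ψ, V_{t,b}⟫`. Then `Φ(ζ, β) = ∫ conj(g) e^{−ζp₀ + iβp₁} dμ'` is holomorphic
on `D` (dominated holomorphic parameter integral: the kernel has modulus `e^{−Re ζ p₀ − Im β p₁} ≤ 1` on the
cone), equals `⟪ψ, V_{t,b}⟫` at real points, and `|Φ| ≤ ‖g‖ ‖e_{ζ,β}‖_{L²} ≤ ‖ψ‖ ‖ψ'‖`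
(`μ'(univ) = ‖ψ'‖²`). No degenerate case is special.

References: K. Osterwalder, R. Schrader, Comm. Math. Phys. 31 (1973), §4.1 (`e^{-tH}`, `U(a⃗)`);
J. Glimm, A. Jaffe, Quantum Physics (2nd ed., 1987), §6.1 (OS reconstruction, contraction semigroup);
M. Reed, B. Simon, Methods of Modern Mathematical Physics I, Thm. VIII.12 (joint spectral measures).
-/

noncomputable section

namespace Summit.QuantumFields.YangMills.Cruxes.PlanarSpectralCone.TwoMirrorLightconeSlots

open MeasureTheory Complex Set Filter
open scoped InnerProductSpace ComplexConjugate
open Literature.MathematicalPhysics.QuantumLattice Literature.MathematicalPhysics.AQFT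
  Literature.MathematicalPhysics.QuantumFieldTheory

local notation "E4" => EuclideanSpace ℝ (Fin 4)

/-- **TRANSFER C⁺ ⇒ C — the holomorphic contraction family on the operator cone.** For ANY labelled family
`T` on `ℝ⁴` with E2 + translations: if EVERY joint spectral measure of EVERY vector is carried by the closed
planar cone `{p₀ ≥ |p₁|}` (operator cone `H ≥ |P₁|`), then for `ψ, ψ'` there is `Φ` holomorphic on
`D = {(ζ,β) : |Im β| < Re ζ}` with `Φ(t,b) = ⟪ψ, e^{-tH} U(b e₁) ψ'⟫` (`t > 0`, `b ∈ ℝ`) and `|Φ| ≤ ‖ψ‖‖ψ'‖`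
on `D` — i.e. `⟪ψ, e^{−ζH + iβP₁}ψ'⟫` as a contraction family, WITHOUT an unbounded functional calculus.
Alias, in this line's namespace, of `PositivityDiscToOperatorCone.Contraction.contractionFamily`
(Gram isometry `L²(μ_{ψ'}) ⊇ span{e^{−tp₀ + ibp₁}} → ℋ`, Hahn–Banach + Riesz representative `g` of
`⟪ψ, ·⟫`, `Φ = ∫ conj(g) e^{−ζp₀ + iβp₁} dμ_{ψ'}`). -/
theorem stub_contractionFamily
    {ι : Type} {T : LabelledSchwingerFamily ι E4} (h : OSReconstructionNoE1 T)
    (hcone : ∀ (ψ : h.Hilbert) (μ : Measure E4), h.IsJointSpectralMeasure ψ μ → μ {p | p 0 < |p 1|} = 0)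
    (ψ ψ' : h.Hilbert) :
    ∃ Φ : ℂ × ℂ → ℂ, DifferentiableOn ℂ Φ {w : ℂ × ℂ | |w.2.im| < w.1.re} ∧
      (∀ t b : ℝ, 0 < t → Φ ((t : ℂ), (b : ℂ)) =
        ⟪ψ, h.transfer t (h.translate (b • EuclideanSpace.single 1 1) ψ')⟫_ℂ) ∧
      ∀ w ∈ {w : ℂ × ℂ | |w.2.im| < w.1.re}, ‖Φ w‖ ≤ ‖ψ‖ * ‖ψ'‖ :=
  _root_.Summit.QuantumFields.YangMills.Cruxes.PlanarSpectralCone.PositivityDiscToOperatorCone.Contraction.contractionFamily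
    h hcone ψ ψ'

end Summit.QuantumFields.YangMills.Cruxes.PlanarSpectralCone.TwoMirrorLightconeSlots
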